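import Mathlib
import Summits.KontsevichZagierPeriods.KontsevichZagierPeriods.Theorems.TorsionLogsNeronTorsionSectorStubCornerChartUpperAux
import HarnessLib

/-!
# Stub `stub_cornerChartUpper` — crux `TorsionLogs.NeronTorsionSector` (stmt-KontsevichZagierPeriods-14500),
line `registered`, block W2: the chart at infinity, upper branch, and the regularisation at `−P₁`

On the real Weierstrass cubic `y² = f(x) = 4x³ − g₂x − g₃` (algebraic data), the compactifying chart
`s = x^{-1/2}` at the point at infinity `O` turns the UPPER branch `y = +√f` translated by
`P₁ = (x₁, y₁)` (`y₁ < 0`, `s₁ = x₁^{-1/2}`) into explicit junk-free formulas: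
`R = √(4 − g₂s⁴ − g₃s⁶)`, `Du = R + y₁s³` (positive on `[0, s₁)`, zero at `s₁`, the chart point of `−P₁`),
`τ̂⁺ = Ñ⁺/(4Du²) − x₁` (`= τ⁺(s⁻²)`), `E = Ñ⁺ − 4x₁Du² = 4Du²τ̂⁺`, the chart image of the translate
`σ = 2Du/√E` (`σ²τ̂⁺ = 1`, `σ(0) = s₁`, `σ(s₁) = 0`), the third-kind potential
`Q̂⁺ = sA₁⁺/(2Du) − √f(τ̂⁺)/(2τ̂⁺)`, and — the one genuinely new computation — a continuous
`ℚ`-semialgebraic extension `T` of `τ ∘ τ̂⁺` through `s₁` (`T(s₁) = x₁`), obtained by dividing the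
numerator of `τ(E/(4Du²))` by `Du²` by hand (`cornerUp_big`), together with the dlog potential
`4K̂⁺√T/E` and its end values.

Proof: the algebra is in the auxiliary file (`cornerUp_*`); here we add the sign bookkeeping
(`Du > 0` on `[0, s₁)` by the intermediate value theorem from `Du(0) = 2` and `Du ≠ 0`, the latter
because `τ̂⁺ > 0 > −x₁`), continuity (`ContinuousOn.div/.sqrt`) and the assembly.

References: J. H. Silverman, *The Arithmetic of Elliptic Curves* (2nd ed., 2009), III.2.3;
M. Kontsevich, D. Zagier, *Periods* (2001), §1.2 rule (2); J. Bochnak, M. Coste, M.-F. Roy,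
*Real Algebraic Geometry* (1998), Prop. 2.2.6.
-/

noncomputable section

-- `Summit.KontsevichZagierPeriods.KontsevichZagierPeriods.…` is the tree's mandated layout (single-conjunct summit).
set_option linter.dupNamespace false

open Set
open Literature.NumberTheory.Transcendental Literature.ModelTheory.ExponentialFields
open Literature.NumberTheory.Transcendental.KZ (isSemialgebraic_setOf_apply_lt_const
  isSemialgebraic_setOf_const_lt_apply)

namespace Summit.KontsevichZagierPeriods.KontsevichZagierPeriods.Cruxes.NeronTorsionSector.Translation

/-- **STUB W2 (`stub_cornerChartUpper`, size L; explicit) — the chart at infinity, upper branch, and the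
regularisation at `−P₁`.** Same chart; upper branch `yb⁺ = +√f`: `Du = R + y₁s³` (positive on `[0, s₁)`,
zero at `s₁`, i.e. at `−P₁`), `Ñ⁺` (sign of the `8y₁sR` term flipped), `τ̂⁺ = Ñ⁺/(4Du²) − x₁` on `[0, s₁)`,
`E := Ñ⁺ − 4x₁Du²` (`= 4Du²τ̂⁺`, positive on `[0, s₁]`, `E(s₁) = s₁⁶f′(x₁)²`), the chart image of the translated
point `σ = 2Du/√E` (`σ² τ̂⁺ = 1`; `σ(0) = s₁`, `σ(s₁) = 0`; junk-free on the closed interval), the potential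
`Q̂⁺ = s·A₁⁺/(2Du) − √f(τ̂⁺)/(2τ̂⁺)` on `[0, s₁)`, a continuous `ℚ`-semialgebraic extension `T` of
`τ ∘ τ̂⁺` to `[0, s₁]` with `T(s₁) = x₁` (divide the numerator of `τ(E/(4Du²))` by `Du²` by hand:
`(E² + 4x₁EDu² + 4cDu⁴)² − 16E(√Φ − y₁Du³)²` is `Du²·(8x₁E³ + 32y₁E·Du·√Φ + …)`, `Φ = E³/16 − g₂EDu⁴/4 − g₃Du⁶`),
and the dlog potential `Ĝs⁺ = 4K̂⁺√T/E`, `K̂⁺ = 4R − L₁sM̂ + 8x₁s²R + 4y₁s³ + 8x₁y₁s⁵` (values `2√(T 0)/x₁` at `0`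
and `−4L₁s₁⁵(12x₁² − g₂)√x₁/E(s₁)` at `s₁`). [cite: KontsevichZagier2001, §1.2 rule (2)]
[cite: SilvermanAEC2009, III.2.3] -/
theorem stub_cornerChartUpper :
    ∀ (g₂ g₃ x₁ y₁ L₁ s₁ : ℝ) (f ybp slp τp τ Pgp R Mh Du Ntp τhp E σ A₁p Qhp Khp : ℝ → ℝ),
    (∀ x, f x = 4 * x ^ 3 - g₂ * x - g₃) → y₁ ^ 2 = f x₁ → y₁ < 0 → 0 < x₁ → 0 < s₁ → s₁ ^ 2 * x₁ = 1 →
    L₁ = (12 * x₁ ^ 2 - g₂) / (2 * y₁) →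
    IsAlgebraic ℚ g₂ → IsAlgebraic ℚ g₃ → IsAlgebraic ℚ x₁ → IsAlgebraic ℚ y₁ →
    ybp = (fun x => Real.sqrt (f x)) →
    slp = (fun x => (4 * x ^ 2 + 4 * x * x₁ + 4 * x₁ ^ 2 - g₂) / (ybp x + y₁)) →
    τp = (fun x => slp x ^ 2 / 4 - x - x₁) →
    τ = (fun x => ((4 * x ^ 2 + 4 * x * x₁ + 4 * x₁ ^ 2 - g₂) / (-Real.sqrt (f x) + y₁)) ^ 2 / 4 - x - x₁) →
    Pgp = (fun x => 4 * (x + 2 * x₁) * y₁ - L₁ * (4 * x ^ 2 + 4 * x * x₁ + 4 * x₁ ^ 2 - g₂)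
      + 4 * (x + 2 * x₁) * ybp x) →
    R = (fun s => Real.sqrt (4 - g₂ * s ^ 4 - g₃ * s ^ 6)) →
    Mh = (fun s => 4 + 4 * x₁ * s ^ 2 + (4 * x₁ ^ 2 - g₂) * s ^ 4) →
    Du = (fun s => R s + y₁ * s ^ 3) →
    Ntp = (fun s => 32 * x₁ + 4 * (12 * x₁ ^ 2 - g₂) * s ^ 2 - 8 * y₁ * s * R s
      + (16 * x₁ ^ 3 - 4 * g₂ * x₁ + 8 * g₃) * s ^ 4 + (4 * x₁ ^ 2 - g₂) ^ 2 * s ^ 6) →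
    τhp = (fun s => Ntp s / (4 * Du s ^ 2) - x₁) →
    E = (fun s => Ntp s - 4 * x₁ * Du s ^ 2) →
    σ = (fun s => 2 * Du s / Real.sqrt (E s)) →
    A₁p = (fun s => 4 * x₁ - y₁ * s * R s + 4 * x₁ ^ 2 * s ^ 2 + g₃ * s ^ 4) →
    Qhp = (fun s => s * A₁p s / (2 * Du s) - Real.sqrt (f (τhp s)) / (2 * τhp s)) →
    Khp = (fun s => 4 * R s - L₁ * s * Mh s + 8 * x₁ * s ^ 2 * R s + 4 * y₁ * s ^ 3 + 8 * x₁ * y₁ * s ^ 5) →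
    (∀ s ∈ Set.Icc 0 s₁, 0 < 4 - g₂ * s ^ 4 - g₃ * s ^ 6) →
    (∀ s ∈ Set.Ico 0 s₁, 0 < τhp s ∧ 0 < f (τhp s) ∧ 0 < τ (τhp s)) →
    (∀ s, 0 < s → s < s₁ →
      Real.sqrt (f (s ^ 2)⁻¹) = R s / s ^ 3 ∧ τhp s = τp (s ^ 2)⁻¹ ∧ 0 < Du s ∧
      σ s ^ 2 * τhp s = 1 ∧ 0 < σ s ∧
      Qhp s = slp (s ^ 2)⁻¹ / 2 - ybp (s ^ 2)⁻¹ / (2 * (s ^ 2)⁻¹)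
        - Real.sqrt (f (τp (s ^ 2)⁻¹)) / (2 * τp (s ^ 2)⁻¹)) ∧
    (Du s₁ = 0 ∧ E s₁ = s₁ ^ 6 * (12 * x₁ ^ 2 - g₂) ^ 2 ∧ (∀ s ∈ Set.Ico 0 s₁, E s = 4 * Du s ^ 2 * τhp s) ∧
      Du 0 = 2 ∧ τhp 0 = x₁ ∧ σ 0 = s₁ ∧ σ s₁ = 0 ∧ Qhp 0 = y₁ / (2 * x₁)) ∧
    (ContinuousOn τhp (Set.Ico 0 s₁) ∧ ContinuousOn Qhp (Set.Ico 0 s₁) ∧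
      ((∀ s ∈ Set.Icc 0 s₁, 0 < E s) → ContinuousOn σ (Set.Icc 0 s₁))) ∧
    (IsSemialgebraicFunOn ℚ {t : Fin 1 → ℝ | t 0 ∈ Set.Ico 0 s₁} (fun t => τhp (t 0)) ∧
      IsSemialgebraicFunOn ℚ {t : Fin 1 → ℝ | t 0 ∈ Set.Ico 0 s₁} (fun t => Qhp (t 0)) ∧
      IsSemialgebraicFunOn ℚ {t : Fin 1 → ℝ | t 0 ∈ Set.Icc 0 s₁} (fun t => σ (t 0))) ∧
    ((∀ s ∈ Set.Icc 0 s₁, 0 < E s) →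
      ∃ T : ℝ → ℝ, ContinuousOn T (Set.Icc 0 s₁) ∧ (∀ s ∈ Set.Ico 0 s₁, T s = τ (τhp s)) ∧ T s₁ = x₁ ∧
        IsSemialgebraicFunOn ℚ {t : Fin 1 → ℝ | t 0 ∈ Set.Icc 0 s₁} (fun t => T (t 0)) ∧
        ((∀ s ∈ Set.Icc 0 s₁, 0 < T s) →
          ContinuousOn (fun s => 4 * Khp s * Real.sqrt (T s) / E s) (Set.Icc 0 s₁) ∧
          IsSemialgebraicFunOn ℚ {t : Fin 1 → ℝ | t 0 ∈ Set.Icc 0 s₁}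
            (fun t => 4 * Khp (t 0) * Real.sqrt (T (t 0)) / E (t 0)) ∧
          (∀ s, 0 < s → s < s₁ → 4 * Khp s * Real.sqrt (T s) / E s =
            Pgp (s ^ 2)⁻¹ / (ybp (s ^ 2)⁻¹ + y₁) ^ 2 * Real.sqrt ((s ^ 2)⁻¹ * τ (τp (s ^ 2)⁻¹)) / τp (s ^ 2)⁻¹) ∧
          4 * Khp 0 * Real.sqrt (T 0) / E 0 = 2 * Real.sqrt (T 0) / x₁ ∧
          Khp s₁ = -(L₁ * s₁ ^ 5 * (12 * x₁ ^ 2 - g₂)))) := by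
  intro g₂ g₃ x₁ y₁ L₁ s₁ f ybp slp τp τ Pgp R Mh Du Ntp τhp E σ A₁p Qhp Khp hf hy1 hy1neg hx1 hs1 hs1x1
    hL1 hg₂a hg₃a hx₁a hy₁a hybp hslp hτp hτ hPgp hR hMh hDu hNtp hτhp hE hσ hA₁p hQhp hKhp hrad hpos
  /- pointwise unfoldings of the definitions -/
  have hRu : ∀ s, R s = Real.sqrt (4 - g₂ * s ^ 4 - g₃ * s ^ 6) := fun s => by rw [hR]
  have hMhu : ∀ s, Mh s = 4 + 4 * x₁ * s ^ 2 + (4 * x₁ ^ 2 - g₂) * s ^ 4 := fun s => by rw [hMh]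
  have hDuu : ∀ s, Du s = R s + y₁ * s ^ 3 := fun s => by rw [hDu]
  have hNtpu : ∀ s, Ntp s = 32 * x₁ + 4 * (12 * x₁ ^ 2 - g₂) * s ^ 2 - 8 * y₁ * s * R s
      + (16 * x₁ ^ 3 - 4 * g₂ * x₁ + 8 * g₃) * s ^ 4 + (4 * x₁ ^ 2 - g₂) ^ 2 * s ^ 6 :=
    fun s => by rw [hNtp]
  have hτhpu : ∀ s, τhp s = Ntp s / (4 * Du s ^ 2) - x₁ := fun s => by rw [hτhp]
  have hEu : ∀ s, E s = Ntp s - 4 * x₁ * Du s ^ 2 := fun s => by rw [hE]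
  have hσu : ∀ s, σ s = 2 * Du s / Real.sqrt (E s) := fun s => by rw [hσ]
  have hA₁pu : ∀ s, A₁p s = 4 * x₁ - y₁ * s * R s + 4 * x₁ ^ 2 * s ^ 2 + g₃ * s ^ 4 :=
    fun s => by rw [hA₁p]
  have hQhpu : ∀ s, Qhp s = s * A₁p s / (2 * Du s) - Real.sqrt (f (τhp s)) / (2 * τhp s) :=
    fun s => by rw [hQhp]
  have hKhpu : ∀ s, Khp s = 4 * R s - L₁ * s * Mh s + 8 * x₁ * s ^ 2 * R s + 4 * y₁ * s ^ 3
      + 8 * x₁ * y₁ * s ^ 5 := fun s => by rw [hKhp]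
  have hybpu : ∀ x, ybp x = Real.sqrt (f x) := fun x => by rw [hybp]
  have hslpu : ∀ x, slp x = (4 * x ^ 2 + 4 * x * x₁ + 4 * x₁ ^ 2 - g₂) / (ybp x + y₁) :=
    fun x => by rw [hslp]
  have hτpu : ∀ x, τp x = slp x ^ 2 / 4 - x - x₁ := fun x => by rw [hτp]
  have hτu : ∀ x, τ x = ((4 * x ^ 2 + 4 * x * x₁ + 4 * x₁ ^ 2 - g₂) / (-Real.sqrt (f x) + y₁)) ^ 2 / 4
      - x - x₁ := fun x => by rw [hτ]
  have hPgpu : ∀ x, Pgp x = 4 * (x + 2 * x₁) * y₁ - L₁ * (4 * x ^ 2 + 4 * x * x₁ + 4 * x₁ ^ 2 - g₂)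
      + 4 * (x + 2 * x₁) * ybp x := fun x => by rw [hPgp]
  have hy : y₁ ^ 2 = 4 * x₁ ^ 3 - g₂ * x₁ - g₃ := by rw [hy1, hf]
  /- `R`: squares, signs, values -/
  have hR2 : ∀ s ∈ Icc 0 s₁, R s ^ 2 = 4 - g₂ * s ^ 4 - g₃ * s ^ 6 := fun s hs => by
    rw [hRu]; exact Real.sq_sqrt (hrad s hs).le
  have hR0 : R 0 = 2 := by
    rw [hRu, show (4 : ℝ) - g₂ * 0 ^ 4 - g₃ * 0 ^ 6 = 2 ^ 2 by norm_num, Real.sqrt_sq (by norm_num)]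
  have hRs1 : R s₁ = -(y₁ * s₁ ^ 3) := by rw [hRu]; exact cornerUp_R_s1 hs1 hy1neg hs1x1 hy
  have hDu0 : Du 0 = 2 := by rw [hDuu, hR0]; ring
  have hNtp0 : Ntp 0 = 32 * x₁ := by rw [hNtpu]; ring
  have hτhp0 : τhp 0 = x₁ := by rw [hτhpu, hNtp0, hDu0]; ring
  have hE0 : E 0 = 16 * x₁ := by rw [hEu, hNtp0, hDu0]; ring
  have hDus1 : Du s₁ = 0 := by rw [hDuu, hRs1]; ring
  have hEs1 : E s₁ = s₁ ^ 6 * (12 * x₁ ^ 2 - g₂) ^ 2 := by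
    rw [hEu, hDus1, hNtpu, hRs1]
    linear_combination cornerUp_Ntp_s1 (g₃ := g₃) hs1x1 hy
  /- `Du ≠ 0` on `[0, s₁)` (else `τ̂⁺ = −x₁ < 0`), continuity, `Du > 0` by the intermediate value theorem -/
  have hDune : ∀ s ∈ Ico 0 s₁, Du s ≠ 0 := by
    intro s hs h0
    have h := (hpos s hs).1
    rw [hτhpu, h0] at h
    simp at h
    linarith
  have hRc : Continuous R := by rw [hR]; fun_prop
  have hDuc : Continuous Du := by rw [hDu]; fun_prop
  have hNtpc : Continuous Ntp := by rw [hNtp]; fun_prop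
  have hEc : Continuous E := by rw [hE]; fun_prop
  have hA₁pc : Continuous A₁p := by rw [hA₁p]; fun_prop
  have hMhc : Continuous Mh := by rw [hMh]; fun_prop
  have hKhpc : Continuous Khp := by rw [hKhp]; fun_prop
  have hfc : Continuous f := by
    rw [show f = fun x => 4 * x ^ 3 - g₂ * x - g₃ from funext hf]; fun_prop
  have hDupos : ∀ s ∈ Ico 0 s₁, 0 < Du s := by
    intro s hs
    by_contra hle
    obtain ⟨c, hc, hc0⟩ :=
      intermediate_value_Icc' hs.1 hDuc.continuousOn ⟨not_lt.mp hle, by rw [hDu0]; norm_num⟩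
    exact hDune c ⟨hc.1, hc.2.trans_lt hs.2⟩ hc0
  /- `E = 4Du²τ̂⁺`, `τ̂⁺ = E/(4Du²)`, `E > 0` on `[0, s₁)` -/
  have hEeq : ∀ s ∈ Ico 0 s₁, E s = 4 * Du s ^ 2 * τhp s := by
    intro s hs
    have hD := hDune s hs
    rw [hEu, hτhpu]
    field_simp
  have hX : ∀ s ∈ Ico 0 s₁, τhp s = E s / (4 * Du s ^ 2) := by
    intro s hs
    have hD := hDune s hs
    rw [hEeq s hs, mul_div_cancel_left₀ _ (by positivity)]
  have hEposI : ∀ s ∈ Ico 0 s₁, 0 < E s := by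
    intro s hs
    rw [hEeq s hs]
    have := hDupos s hs
    have := (hpos s hs).1
    positivity
  have hτcont : ContinuousOn τhp (Ico 0 s₁) := by
    rw [hτhp]
    refine (hNtpc.continuousOn.div (by fun_prop) fun s hs => ?_).sub continuousOn_const
    have := hDune s hs
    positivity
  /- the chart identities `√f(s⁻²) = R/s³`, `τ̂⁺(s) = τ⁺(s⁻²)` for `0 < s < s₁` -/
  have chart : ∀ s, 0 < s → s < s₁ →
      Real.sqrt (f (s ^ 2)⁻¹) = R s / s ^ 3 ∧ τhp s = τp (s ^ 2)⁻¹ := by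
    intro s hs0 hss
    have hsI : s ∈ Icc 0 s₁ := ⟨hs0.le, hss.le⟩
    have hsq : Real.sqrt (f (s ^ 2)⁻¹) = R s / s ^ 3 := by
      rw [hf, hRu]; exact cornerUp_sqrt_chart hs0 (hrad s hsI).le
    refine ⟨hsq, ?_⟩
    have hD : R s + y₁ * s ^ 3 ≠ 0 := by rw [← hDuu]; exact hDune s ⟨hs0.le, hss⟩
    rw [hτpu, hslpu, hybpu, hsq, hτhpu, hNtpu, hDuu]
    exact cornerUp_tau_chart hs0.ne' hD (hR2 s hsI) hy
  refine ⟨?_, ⟨hDus1, hEs1, hEeq, hDu0, hτhp0, ?_, ?_, ?_⟩, ⟨hτcont, ?_, ?_⟩, ?_, ?_⟩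
  /- (i) the chart identities on `0 < s < s₁` -/
  · intro s hs0 hss
    obtain ⟨hsq, hτc⟩ := chart s hs0 hss
    have hsI' : s ∈ Ico 0 s₁ := ⟨hs0.le, hss⟩
    have hsI : s ∈ Icc 0 s₁ := ⟨hs0.le, hss.le⟩
    have hD := hDupos s hsI'
    have hEp := hEposI s hsI'
    have hτ0 := (hpos s hsI').1
    refine ⟨hsq, hτc, hD, ?_, ?_, ?_⟩
    · rw [hσu, div_pow, mul_pow, Real.sq_sqrt hEp.le, hEeq s hsI']
      field_simp
      norm_num
    · rw [hσu]; exact div_pos (by linarith) (Real.sqrt_pos.2 hEp)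
    · have hD' : R s + y₁ * s ^ 3 ≠ 0 := by rw [← hDuu]; exact hD.ne'
      have hq : s * A₁p s / (2 * Du s) = slp (s ^ 2)⁻¹ / 2 - ybp (s ^ 2)⁻¹ / (2 * (s ^ 2)⁻¹) := by
        rw [hslpu, hybpu, hsq, hA₁pu, hDuu]
        exact cornerUp_Q_chart hs0.ne' hD' (hR2 s hsI)
      rw [hQhpu, hτc, hq]
  /- (ii) values: `σ 0 = s₁` -/
  · rw [hσu, hDu0, hE0]
    have h16 : Real.sqrt (16 * x₁) = 4 / s₁ := by
      rw [Real.sqrt_eq_iff_mul_self_eq_of_pos (by positivity)]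
      field_simp
      linear_combination (-16) * hs1x1
    rw [h16, div_div_eq_mul_div, div_eq_iff (by norm_num : (4 : ℝ) ≠ 0)]
    ring
  /- `σ s₁ = 0` -/
  · rw [hσu, hDus1]; simp
  /- `Q̂⁺ 0 = y₁/(2x₁)` -/
  · rw [hQhpu, hτhp0, ← hy1, Real.sqrt_sq_eq_abs, abs_of_neg hy1neg]
    ring
  /- (iii) continuity of `Q̂⁺` on `[0, s₁)` -/
  · rw [hQhp]
    refine ContinuousOn.sub ?_ ?_
    · refine ContinuousOn.div (by fun_prop) (by fun_prop) fun s hs => ?_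
      have := hDune s hs
      positivity
    · refine ContinuousOn.div ((hfc.comp_continuousOn hτcont).sqrt) (continuousOn_const.mul hτcont)
        fun s hs => ?_
      have := (hpos s hs).1
      positivity
  /- continuity of `σ` on `[0, s₁]` when `E > 0` there -/
  · intro hEpos
    rw [hσ]
    exact (continuousOn_const.mul hDuc.continuousOn).div hEc.continuousOn.sqrt
      fun s hs => (Real.sqrt_pos.2 (hEpos s hs)).ne'
  /- (iv) semialgebraicity -/
  · have hs₁a : IsAlgebraic ℚ s₁ := by
      refine IsAlgebraic.of_pow two_pos ?_
      rw [eq_inv_of_mul_eq_one_left hs1x1]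
      exact hx₁a.inv
    have hL₁a : IsAlgebraic ℚ L₁ := by
      have h12 : IsAlgebraic ℚ (12 : ℝ) := by exact_mod_cast isAlgebraic_nat (R := ℚ) (A := ℝ) 12
      have h2 : IsAlgebraic ℚ (2 : ℝ) := by exact_mod_cast isAlgebraic_nat (R := ℚ) (A := ℝ) 2
      rw [hL1, div_eq_mul_inv]
      exact ((h12.mul (hx₁a.pow 2)).sub hg₂a).mul (h2.mul hy₁a).inv
    -- the slabs `{t | t 0 ∈ [0, s₁)}` and `{t | t 0 ∈ [0, s₁]}` are `ℚ`-semialgebraic (algebraic ends)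
    have h0a : IsAlgebraic ℚ (0 : ℝ) := isAlgebraic_zero
    have hSI : IsSemialgebraic ℚ {t : Fin 1 → ℝ | t 0 ∈ Set.Ico 0 s₁} := by
      have h : {t : Fin 1 → ℝ | t 0 ∈ Set.Ico 0 s₁} =
          {t : Fin 1 → ℝ | t 0 < 0}ᶜ ∩ {t : Fin 1 → ℝ | t 0 < s₁} := by
        ext t
        simp [not_lt]
      rw [h]
      exact (isSemialgebraic_setOf_apply_lt_const h0a 0).compl.inter
        (isSemialgebraic_setOf_apply_lt_const hs₁a 0)
    have hSC : IsSemialgebraic ℚ {t : Fin 1 → ℝ | t 0 ∈ Set.Icc 0 s₁} := by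
      have h : {t : Fin 1 → ℝ | t 0 ∈ Set.Icc 0 s₁} =
          {t : Fin 1 → ℝ | t 0 < 0}ᶜ ∩ {t : Fin 1 → ℝ | s₁ < t 0}ᶜ := by
        ext t
        simp [not_lt]
      rw [h]
      exact (isSemialgebraic_setOf_apply_lt_const h0a 0).compl.inter
        (isSemialgebraic_setOf_const_lt_apply hs₁a 0).compl
    obtain ⟨sτ, -, sQ, -, -⟩ := cornerUp_semialg hg₂a hg₃a hx₁a hy₁a hL₁a hSI hf hR hMh hDu hNtp hτhp
      hE hσ hA₁p hQhp hKhp rfl rfl rfl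
    obtain ⟨-, sσ, -, -, -⟩ := cornerUp_semialg hg₂a hg₃a hx₁a hy₁a hL₁a hSC hf hR hMh hDu hNtp hτhp
      hE hσ hA₁p hQhp hKhp rfl rfl rfl
    exact ⟨sτ, sQ, sσ⟩
  /- (v) the regularisation at `−P₁` -/
  · intro hEpos
    obtain ⟨Φf, hΦf⟩ : ∃ Φf : ℝ → ℝ,
        Φf = fun s => E s ^ 3 / 16 - g₂ * E s * Du s ^ 4 / 4 - g₃ * Du s ^ 6 := ⟨_, rfl⟩
    obtain ⟨Pf, hPf⟩ : ∃ Pf : ℝ → ℝ,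
        Pf = fun s => 8 * x₁ * E s ^ 3 + 4 * (12 * x₁ ^ 2 - g₂) * E s ^ 2 * Du s ^ 2
          + 32 * y₁ * E s * Du s * Real.sqrt (Φf s) + 16 * (4 * x₁ ^ 3 - g₂ * x₁ + 2 * g₃) * E s * Du s ^ 4
          + 16 * (4 * x₁ ^ 2 - g₂) ^ 2 * Du s ^ 6 := ⟨_, rfl⟩
    obtain ⟨T, hT⟩ : ∃ T : ℝ → ℝ,
        T = fun s => Pf s / (64 * (Real.sqrt (Φf s) - y₁ * Du s ^ 3) ^ 2) - x₁ := ⟨_, rfl⟩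
    have hΦu : ∀ s, Φf s = E s ^ 3 / 16 - g₂ * E s * Du s ^ 4 / 4 - g₃ * Du s ^ 6 :=
      fun s => by rw [hΦf]
    have hPu : ∀ s, Pf s = 8 * x₁ * E s ^ 3 + 4 * (12 * x₁ ^ 2 - g₂) * E s ^ 2 * Du s ^ 2
        + 32 * y₁ * E s * Du s * Real.sqrt (Φf s) + 16 * (4 * x₁ ^ 3 - g₂ * x₁ + 2 * g₃) * E s * Du s ^ 4
        + 16 * (4 * x₁ ^ 2 - g₂) ^ 2 * Du s ^ 6 := fun s => by rw [hPf]
    have hTu : ∀ s, T s = Pf s / (64 * (Real.sqrt (Φf s) - y₁ * Du s ^ 3) ^ 2) - x₁ :=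
      fun s => by rw [hT]
    -- `Φ = Du⁶ f(τ̂⁺)` on `[0, s₁)`, `Φ > 0` on `[0, s₁]`, `√Φ − y₁Du³ > 0` on `[0, s₁]`
    have hΦI : ∀ s ∈ Ico 0 s₁, Φf s = Du s ^ 6 * f (τhp s) := by
      intro s hs
      have hD := hDune s hs
      rw [hΦu, hf, hX s hs, cornerUp_f_X hD]
      field_simp
    have hΦpos : ∀ s ∈ Icc 0 s₁, 0 < Φf s := by
      intro s hs
      rcases eq_or_lt_of_le hs.2 with h | h
      · rw [h, hΦu, hDus1]
        have := hEpos s₁ ⟨hs1.le, le_rfl⟩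
        norm_num
        positivity
      · rw [hΦI s ⟨hs.1, h⟩]
        exact mul_pos (pow_pos (hDupos s ⟨hs.1, h⟩) 6) (hpos s ⟨hs.1, h⟩).2.1
    have hDunn : ∀ s ∈ Icc 0 s₁, 0 ≤ Du s := by
      intro s hs
      rcases eq_or_lt_of_le hs.2 with h | h
      · rw [h, hDus1]
      · exact (hDupos s ⟨hs.1, h⟩).le
    have hBpos : ∀ s ∈ Icc 0 s₁, 0 < Real.sqrt (Φf s) - y₁ * Du s ^ 3 := by
      intro s hs
      have h1 := Real.sqrt_pos.2 (hΦpos s hs)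
      have h2 : 0 ≤ -y₁ * Du s ^ 3 := mul_nonneg (neg_nonneg.2 hy1neg.le) (pow_nonneg (hDunn s hs) 3)
      linarith
    -- `T = τ ∘ τ̂⁺` on `[0, s₁)`
    have hTeq : ∀ s ∈ Ico 0 s₁, T s = τ (τhp s) := by
      intro s hs
      have hsC : s ∈ Icc 0 s₁ := ⟨hs.1, hs.2.le⟩
      have hB := hBpos s hsC
      have hΦ0 := (hΦpos s hsC).le
      rw [hΦu] at hB hΦ0
      rw [hTu, hPu, hΦu, hτu, hf, hX s hs, cornerUp_sqrt_f_X (hDupos s hs)]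
      exact (cornerUp_T_eq (hDune s hs) hB.ne' (Real.sq_sqrt hΦ0) hy).symm
    -- `T s₁ = x₁`
    have hTs1 : T s₁ = x₁ := by
      have hE1 := hEpos s₁ ⟨hs1.le, le_rfl⟩
      rw [hTu, hPu, hΦu, hDus1]
      norm_num
      rw [div_pow, Real.sq_sqrt (by positivity)]
      field_simp
      ring
    -- continuity of `T` on `[0, s₁]`
    have hΦc : Continuous Φf := by rw [hΦf]; fun_prop
    have hPc : Continuous Pf := by rw [hPf]; fun_prop
    have hTc : ContinuousOn T (Icc 0 s₁) := by
      rw [hT]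
      refine (hPc.continuousOn.div (by fun_prop) fun s hs => ?_).sub continuousOn_const
      have := hBpos s hs
      positivity
    -- semialgebraicity of `T` and of the dlog potential
    have hs₁a : IsAlgebraic ℚ s₁ := by
      refine IsAlgebraic.of_pow two_pos ?_
      rw [eq_inv_of_mul_eq_one_left hs1x1]
      exact hx₁a.inv
    have hL₁a : IsAlgebraic ℚ L₁ := by
      have h12 : IsAlgebraic ℚ (12 : ℝ) := by exact_mod_cast isAlgebraic_nat (R := ℚ) (A := ℝ) 12
      have h2 : IsAlgebraic ℚ (2 : ℝ) := by exact_mod_cast isAlgebraic_nat (R := ℚ) (A := ℝ) 2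
      rw [hL1, div_eq_mul_inv]
      exact ((h12.mul (hx₁a.pow 2)).sub hg₂a).mul (h2.mul hy₁a).inv
    have hSC : IsSemialgebraic ℚ {t : Fin 1 → ℝ | t 0 ∈ Set.Icc 0 s₁} := by
      have h : {t : Fin 1 → ℝ | t 0 ∈ Set.Icc 0 s₁} =
          {t : Fin 1 → ℝ | t 0 < 0}ᶜ ∩ {t : Fin 1 → ℝ | s₁ < t 0}ᶜ := by
        ext t
        simp [not_lt]
      rw [h]
      exact (isSemialgebraic_setOf_apply_lt_const isAlgebraic_zero 0).compl.inter
        (isSemialgebraic_setOf_const_lt_apply hs₁a 0).compl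
    obtain ⟨-, -, -, sT, sG⟩ := cornerUp_semialg hg₂a hg₃a hx₁a hy₁a hL₁a hSC hf hR hMh hDu hNtp hτhp
      hE hσ hA₁p hQhp hKhp hΦf hPf hT
    refine ⟨T, hTc, hTeq, hTs1, sT, fun hTpos => ⟨?_, sG, ?_, ?_, ?_⟩⟩
    · -- continuity of `4K̂⁺√T/E` on `[0, s₁]`
      exact ((continuousOn_const.mul hKhpc.continuousOn).mul hTc.sqrt).div hEc.continuousOn
        fun s hs => (hEpos s hs).ne'
    · -- agreement with the x-chart dlog potential on `0 < s < s₁`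
      intro s hs0 hss
      obtain ⟨hsq, hτc'⟩ := chart s hs0 hss
      have hsI : s ∈ Ico 0 s₁ := ⟨hs0.le, hss⟩
      have hD : R s + y₁ * s ^ 3 ≠ 0 := by rw [← hDuu]; exact hDune s hsI
      rw [← hτc', ← hTeq s hsI, hPgpu, hybpu, hsq, hX s hsI, hKhpu, hMhu, hDuu,
        Real.sqrt_mul (by positivity) (T s), Real.sqrt_inv, Real.sqrt_sq hs0.le]
      exact cornerUp_G_chart hs0.ne' hD (hEposI s hsI).ne'
    · -- the value at `s = 0`
      rw [hKhpu, hR0, hE0]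
      field_simp
      ring
    · -- `K̂⁺(s₁)`
      rw [hKhpu, hMhu, hRs1]
      exact cornerUp_Khp_s1 hs1x1

end Summit.KontsevichZagierPeriods.KontsevichZagierPeriods.Cruxes.NeronTorsionSector.Translation
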